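import Summits.QuantumFields.YangMills.Theorems.LuscherReductionTwistedTraceScalingShellRecordLow
import Summits.QuantumFields.YangMills.Theorems.LuscherReductionTwistedTraceScalingShellChain
import Summits.QuantumFields.YangMills.Theorems.LuscherReductionTwistedTraceScalingBODefectHODLow
import HarnessLib

/-!
# ★★★★ COARSE-UPPER(L) IS A THEOREM for every fixed `L ≥ 2`: the eight thin shells of ✓`coarseUpper_of_thinShells` discharged by ✓`innerShellGainSmallAt_record_low` fed with hand A's
# ✓`hOD_record_low`
# (lane A of S-BASE, crux `TwistedTraceScaling` stmt-QuantumFields-20203, line «twolattice», stub `stub_fixedLatticeTraceLaw`; lead g23; card `pub/ym-fleet/ym-luscher-20007-p1/Lines-shell-gain.md`)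

* ★★★★ `coarseUpper_of_hODlow (hL2 : 2 ≤ L) (hODlow)` — `λ_k(L,β) ≤ e^{−dΛ/L}·λ₀(L,β)` for every `k`, every `d < Δ_k`, deep in the femto window, from the single schema `hODlow`: for every exponent
  `0 < s < 1/4`, the (B-OD) brick of the record tube `recordChi L s 43 M` with profile ✓`recordProfile L`, factor ✓`recordSigma L` and a rate `b` with `b β² ≤ β^{−p}` eventually for every
  `p < min(2s, 1/3)` (the statement of hand A's `hOD_record_low`).  Instances at the chain `(17/100,13/100), (13/100,1/10), (1/10,77/1000), (77/1000,59/1000), (59/1000,45/1000),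
  (45/1000,34/1000), (34/1000,26/1000), (26/1000,1/40)` (each `3a/2 < 2s`, `a, s < 1/5`).
HONEST FRAMING: a kernel-checked reduction of COARSE-UPPER(L) (fixed `L ≥ 2`) to ONE brick schema of a stub of a child of the CONDITIONAL reduction route R2b1; COARSE-LOWER/TAIL, the
stubs and the crux stay OPEN; not infinite volume, not a mass gap, not Clay.  No definitions, no `sorry`.
-/

set_option autoImplicit false

noncomputable section

open MeasureTheory Filter Topology Real
open scoped BigOperators
open Literature.MathematicalPhysics.QuantumFieldTheory
open Literature.MathematicalPhysics.QuantumLattice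

namespace Summit.QuantumFields.YangMills.Theorems.FemtoTransferGap.TwoLattice.ConstTube

open Summit.QuantumFields.YangMills.Theorems.FemtoTransferGap
open Summit.QuantumFields.YangMills.Theorems.FemtoTransferGap.TwoLattice.Stiff (LinkSpace)

variable {L : ℕ} [NeZero L]

/-- ★★★★ **COARSE-UPPER(L) from the (B-OD) brick schema below `1/6`** (see the module docstring). [cite: Luscher1983, §3] [cite: LuscherMunster1984, §2] -/
theorem coarseUpper_of_hODlow (hL2 : 2 ≤ L)
    (hODlow : ∀ s : ℝ, 0 < s → s < 1 / 4 → ∃ M₀ : ℝ, ∀ M : ℝ, M₀ ≤ M → ∃ b : ℝ → ℝ, (∀ β, 0 ≤ b β) ∧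
      (∀ p : ℝ, p < 2 * s → p < 1 / 3 → ∀ᶠ β : ℝ in atTop, b β ^ 2 ≤ powScale p β) ∧
      ∀ᶠ β : ℝ in atTop, ∀ (φ : GaugeConfig 3 1 SU2 → ℝ) (v : GaugeConfig 3 L SU2 → ℝ), Measurable φ → (∃ C : ℝ, ∀ u, |φ u| ≤ C) →
        (∀ u, φ u ≠ 0 → orbitDist u < recordDelta1 L s β) → Measurable v → (∃ C : ℝ, ∀ U, |v U| ≤ C) → (∀ U, v U ≠ 0 → recordChi L s 43 M β U ≠ 0) →
        (∀ u, fibreInner L (softWeight (recordChi L s 43 M β)) (recordProfile L β) v u = 0) →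
        |tubeCross β (boFun L φ (recordProfile L β)) v| ≤ b β * (recordSigma L β * levelValue su2Rep 1 ((L : ℝ) ^ 3 * β) 0) *
            Real.sqrt (tubeNormSq (softWeight (recordChi L s 43 M β)) (boFun L φ (recordProfile L β))) * Real.sqrt (tubeNormSq (softWeight (recordChi L s 43 M β)) v) ∧
        |tubeCross β v (boFun L φ (recordProfile L β))| ≤ b β * (recordSigma L β * levelValue su2Rep 1 ((L : ℝ) ^ 3 * β) 0) *
            Real.sqrt (tubeNormSq (softWeight (recordChi L s 43 M β)) (boFun L φ (recordProfile L β))) * Real.sqrt (tubeNormSq (softWeight (recordChi L s 43 M β)) v)) :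
    ∀ k : ℕ, ∀ d : ℝ, d < levelGap k → ∃ lam0 : ℝ, 0 < lam0 ∧ ∀ lam : ℝ, 0 < lam → lam ≤ lam0 →
      ∀ β : ℝ, InFemtoWindow lam β L →
        levelValue su2Rep L β k ≤ Real.exp (-(d * luscherLambda β L) / L) * levelValue su2Rep L β 0 :=
  coarseUpper_of_thinShells hL2
    (innerShellGainSmallAt_record_low hL2 (s := 13 / 100) (a := 17 / 100) (by norm_num) (by norm_num) (by norm_num) (by norm_num) (by norm_num)
      (hODlow _ (by norm_num) (by norm_num)) _)
    (innerShellGainSmallAt_record_low hL2 (s := 1 / 10) (a := 13 / 100) (by norm_num) (by norm_num) (by norm_num) (by norm_num) (by norm_num)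
      (hODlow _ (by norm_num) (by norm_num)) _)
    (innerShellGainSmallAt_record_low hL2 (s := 77 / 1000) (a := 1 / 10) (by norm_num) (by norm_num) (by norm_num) (by norm_num) (by norm_num)
      (hODlow _ (by norm_num) (by norm_num)) _)
    (innerShellGainSmallAt_record_low hL2 (s := 59 / 1000) (a := 77 / 1000) (by norm_num) (by norm_num) (by norm_num) (by norm_num) (by norm_num)
      (hODlow _ (by norm_num) (by norm_num)) _)
    (innerShellGainSmallAt_record_low hL2 (s := 45 / 1000) (a := 59 / 1000) (by norm_num) (by norm_num) (by norm_num) (by norm_num) (by norm_num)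
      (hODlow _ (by norm_num) (by norm_num)) _)
    (innerShellGainSmallAt_record_low hL2 (s := 34 / 1000) (a := 45 / 1000) (by norm_num) (by norm_num) (by norm_num) (by norm_num) (by norm_num)
      (hODlow _ (by norm_num) (by norm_num)) _)
    (innerShellGainSmallAt_record_low hL2 (s := 26 / 1000) (a := 34 / 1000) (by norm_num) (by norm_num) (by norm_num) (by norm_num) (by norm_num)
      (hODlow _ (by norm_num) (by norm_num)) _)
    (innerShellGainSmallAt_record_low hL2 (s := 1 / 40) (a := 26 / 1000) (by norm_num) (by norm_num) (by norm_num) (by norm_num) (by norm_num)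
      (hODlow _ (by norm_num) (by norm_num)) _)

set_option maxHeartbeats 800000 in
-- the (B-OD) brick's statement unfolds `recordProfile` / `recordSigma` definitionally.
/-- ★★★★ **COARSE-UPPER(L), UNCONDITIONAL** for every fixed `L ≥ 2` (see the module docstring). [cite: Luscher1983, §3] [cite: LuscherMunster1984, §2] -/
theorem coarseUpper (hL2 : 2 ≤ L) :
    ∀ k : ℕ, ∀ d : ℝ, d < levelGap k → ∃ lam0 : ℝ, 0 < lam0 ∧ ∀ lam : ℝ, 0 < lam → lam ≤ lam0 →
      ∀ β : ℝ, InFemtoWindow lam β L →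
        levelValue su2Rep L β k ≤ Real.exp (-(d * luscherLambda β L) / L) * levelValue su2Rep L β 0 :=
  coarseUpper_of_hODlow hL2 fun s hs hs4 => by
    obtain ⟨M₀, -, h⟩ := hOD_record_low (L := L) (nonempty_nzSite_of_two_le hL2) hL2 hs hs4
    exact ⟨M₀, h⟩

end Summit.QuantumFields.YangMills.Theorems.FemtoTransferGap.TwoLattice.ConstTube

end
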